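import Summits.Ventures.CertifiedArithmetic.LowPrec.AccumulateLangeRump
import Summits.Ventures.CertifiedArithmetic.LowPrec.AccumulateAllN
import Summits.Ventures.CertifiedArithmetic.LowPrec.ExactInstances
import Summits.Ventures.CertifiedArithmetic.LowPrec.AccumulateRange
import Summits.Ventures.CertifiedArithmetic.LowPrec.AccumulateHeight

/-!
# Inner products with exact products under the Lange–Rump constants (GEMM packaging)

HONEST FRAMING (venture CertifiedArithmetic / cell `pub-lowprec`): certified error envelopes and
provably optimal rounding/accumulation schemes for low-precision formats under stated cost models;
every table by two implementations; no hardware or vendor claims.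

The cell's GEMM note measures `W(n) = max |ŝ - s|/Σ|aᵢbᵢ|` for inner products whose products are
EXACT in the accumulator format (FP8/FP6/FP4 factors into bfloat16/binary32, `Exact.lean` /
`ExactInstances.lean`) and cites Lange–Rump's `(n-1)u/(1+(n-1)u)` (Theorem LR) for the range
`n - 1 ≤ ½u⁻¹`. This file packages `AccumulateLangeRump.lean` (sharp constant, restricted `n`) and
`AccumulateAllN.lean` (all `n`, factor `< 1`) for such inner products in the recursive order of the
note (`seqSum` over the products; `n` additions for `n + 1` products):
`abs_seqSum_dot_sub_le_langeRump`, `abs_seqSum_dot_sub_le_allN`, and the instances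
`E4M3_dot_BFloat16_langeRump` / `E5M2_dot_BFloat16_langeRump` / `E4M3_E5M2_dot_BFloat16_langeRump` /
`E2M1_dot_BFloat16_langeRump` (`n ≤ 128` additions, i.e. the note's `n ≤ 129` products) and
`E4M3_dot_Binary32_langeRump` (`n ≤ 2^23`). Pairwise / blocked orders: apply
`abs_eval_sub_exact_le_langeRump` / `abs_twoLevel_sub_exact_le_langeRump` to the tree of products.
-/

namespace Literature.ComputerArithmetic.FloatingPoint

namespace MiniFloat

open Finset

variable {φ₁ φ₂ α : Format}

/-- INNER PRODUCT, recursive order, exact products, Lange–Rump constant: if every product `aᵢbᵢ`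
is a value of the accumulator format `α` (`emaxCode ≥ 2`), no step leaves the range and
`n ≤ ½u⁻¹` additions, then `|ŝₙ - Σ_{i≤n} aᵢbᵢ| ≤ n·u/(1+n·u) · Σ_{i≤n}|aᵢbᵢ|`.
[cite: BoldoEtAl2023, Thm 4.5] -/
theorem abs_seqSum_dot_sub_le_langeRump (hα : 2 ≤ α.emaxCode)
    (hexact : ∀ (a : MiniFloat φ₁) (b : MiniFloat φ₂), ∃ z : MiniFloat α, z.toRat = a.toRat * b.toRat)
    (a : ℕ → MiniFloat φ₁) (b : ℕ → MiniFloat φ₂) (n : ℕ)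
    (hr : InRange α (fun i => (a i).toRat * (b i).toRat) n)
    (hn : 2 * (n : ℚ) * α.unitRoundoff ≤ 1) :
    |(seqSum α (fun i => (a i).toRat * (b i).toRat) n).toRat
        - ∑ i ∈ range (n + 1), (a i).toRat * (b i).toRat|
      ≤ (n : ℚ) * α.unitRoundoff / (1 + (n : ℚ) * α.unitRoundoff)
        * ∑ i ∈ range (n + 1), |(a i).toRat * (b i).toRat| :=
  abs_seqSum_sub_sum_le_langeRump hα _ n (fun i _ => hexact (a i) (b i)) hr hn

/-- INNER PRODUCT, recursive order, exact products, EVERY `n` (no restriction):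
`|ŝₙ - Σ aᵢbᵢ| ≤ ((1+2u)ⁿ - 1)/((1+2u)ⁿ + 1) · Σ|aᵢbᵢ|` (`< Σ|aᵢbᵢ|`).
[cite: LangeRump2018, Thm 10] -/
theorem abs_seqSum_dot_sub_le_allN (hα : 2 ≤ α.emaxCode)
    (hexact : ∀ (a : MiniFloat φ₁) (b : MiniFloat φ₂), ∃ z : MiniFloat α, z.toRat = a.toRat * b.toRat)
    (a : ℕ → MiniFloat φ₁) (b : ℕ → MiniFloat φ₂) (n : ℕ)
    (hr : InRange α (fun i => (a i).toRat * (b i).toRat) n) :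
    |(seqSum α (fun i => (a i).toRat * (b i).toRat) n).toRat
        - ∑ i ∈ range (n + 1), (a i).toRat * (b i).toRat|
      ≤ langeRumpAllN α n * ∑ i ∈ range (n + 1), |(a i).toRat * (b i).toRat| :=
  abs_seqSum_sub_sum_le_allN hα _ n (fun i _ => hexact (a i) (b i)) hr

/-- bfloat16 restriction: `n ≤ 128` additions satisfy `2·n·u ≤ 1` (`u = 2^-8`). [folklore] -/
theorem BFloat16_langeRump_restriction {n : ℕ} (hn : n ≤ 128) :
    2 * (n : ℚ) * Format.BFloat16.unitRoundoff ≤ 1 := by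
  rw [Format.unitRoundoff_eq]
  have : (n : ℚ) ≤ 128 := by exact_mod_cast hn
  norm_num [Format.BFloat16]
  linarith

/-- binary32 restriction: `n ≤ 2^23` additions satisfy `2·n·u ≤ 1` (`u = 2^-24`). [folklore] -/
theorem Binary32_langeRump_restriction {n : ℕ} (hn : n ≤ 2 ^ 23) :
    2 * (n : ℚ) * Format.Binary32.unitRoundoff ≤ 1 := by
  rw [Format.unitRoundoff_eq]
  have : (n : ℚ) ≤ 2 ^ 23 := by exact_mod_cast hn
  norm_num [Format.Binary32]
  linarith

/-- `E4M3 × E4M3 → bfloat16`, recursive, `n ≤ 128` additions (the GEMM note's `n ≤ 129` products):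
`|ŝₙ - Σ aᵢbᵢ| ≤ n u/(1 + n u)·Σ|aᵢbᵢ|`, `u = 2^-8`. [cite: BoldoEtAl2023, Thm 4.5] -/
theorem E4M3_dot_BFloat16_langeRump (a b : ℕ → MiniFloat Format.E4M3) (n : ℕ) (hn : n ≤ 128)
    (hr : InRange Format.BFloat16 (fun i => (a i).toRat * (b i).toRat) n) :
    |(seqSum Format.BFloat16 (fun i => (a i).toRat * (b i).toRat) n).toRat
        - ∑ i ∈ range (n + 1), (a i).toRat * (b i).toRat|
      ≤ (n : ℚ) * Format.BFloat16.unitRoundoff / (1 + (n : ℚ) * Format.BFloat16.unitRoundoff)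
        * ∑ i ∈ range (n + 1), |(a i).toRat * (b i).toRat| :=
  abs_seqSum_dot_sub_le_langeRump (by decide) Format.E4M3_mul_E4M3_exact_in_BFloat16 a b n hr
    (BFloat16_langeRump_restriction hn)

/-- `E5M2 × E5M2 → bfloat16`, recursive, `n ≤ 128` additions. [cite: BoldoEtAl2023, Thm 4.5] -/
theorem E5M2_dot_BFloat16_langeRump (a b : ℕ → MiniFloat Format.E5M2) (n : ℕ) (hn : n ≤ 128)
    (hr : InRange Format.BFloat16 (fun i => (a i).toRat * (b i).toRat) n) :
    |(seqSum Format.BFloat16 (fun i => (a i).toRat * (b i).toRat) n).toRat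
        - ∑ i ∈ range (n + 1), (a i).toRat * (b i).toRat|
      ≤ (n : ℚ) * Format.BFloat16.unitRoundoff / (1 + (n : ℚ) * Format.BFloat16.unitRoundoff)
        * ∑ i ∈ range (n + 1), |(a i).toRat * (b i).toRat| :=
  abs_seqSum_dot_sub_le_langeRump (by decide) Format.E5M2_mul_E5M2_exact_in_BFloat16 a b n hr
    (BFloat16_langeRump_restriction hn)

/-- `E4M3 × E5M2 → bfloat16`, recursive, `n ≤ 128` additions. [cite: BoldoEtAl2023, Thm 4.5] -/
theorem E4M3_E5M2_dot_BFloat16_langeRump (a : ℕ → MiniFloat Format.E4M3)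
    (b : ℕ → MiniFloat Format.E5M2) (n : ℕ) (hn : n ≤ 128)
    (hr : InRange Format.BFloat16 (fun i => (a i).toRat * (b i).toRat) n) :
    |(seqSum Format.BFloat16 (fun i => (a i).toRat * (b i).toRat) n).toRat
        - ∑ i ∈ range (n + 1), (a i).toRat * (b i).toRat|
      ≤ (n : ℚ) * Format.BFloat16.unitRoundoff / (1 + (n : ℚ) * Format.BFloat16.unitRoundoff)
        * ∑ i ∈ range (n + 1), |(a i).toRat * (b i).toRat| :=
  abs_seqSum_dot_sub_le_langeRump (by decide) Format.E4M3_mul_E5M2_exact_in_BFloat16 a b n hr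
    (BFloat16_langeRump_restriction hn)

/-- `E2M1 × E2M1 → bfloat16` (the note's headline alphabet), recursive, `n ≤ 128` additions: the
theorem side of the certified `W(n) = (n-1)u/(1+(n-1)u)`, `2 ≤ n ≤ 129` (products).
[cite: BoldoEtAl2023, Thm 4.5] -/
theorem E2M1_dot_BFloat16_langeRump (a b : ℕ → MiniFloat Format.E2M1) (n : ℕ) (hn : n ≤ 128)
    (hr : InRange Format.BFloat16 (fun i => (a i).toRat * (b i).toRat) n) :
    |(seqSum Format.BFloat16 (fun i => (a i).toRat * (b i).toRat) n).toRat
        - ∑ i ∈ range (n + 1), (a i).toRat * (b i).toRat|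
      ≤ (n : ℚ) * Format.BFloat16.unitRoundoff / (1 + (n : ℚ) * Format.BFloat16.unitRoundoff)
        * ∑ i ∈ range (n + 1), |(a i).toRat * (b i).toRat| :=
  abs_seqSum_dot_sub_le_langeRump (by decide) Format.E2M1_mul_E2M1_exact_in_BFloat16 a b n hr
    (BFloat16_langeRump_restriction hn)

/-- `E4M3 × E4M3 → binary32`, recursive, `n ≤ 2^23` additions. [cite: BoldoEtAl2023, Thm 4.5] -/
theorem E4M3_dot_Binary32_langeRump (a b : ℕ → MiniFloat Format.E4M3) (n : ℕ) (hn : n ≤ 2 ^ 23)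
    (hr : InRange Format.Binary32 (fun i => (a i).toRat * (b i).toRat) n) :
    |(seqSum Format.Binary32 (fun i => (a i).toRat * (b i).toRat) n).toRat
        - ∑ i ∈ range (n + 1), (a i).toRat * (b i).toRat|
      ≤ (n : ℚ) * Format.Binary32.unitRoundoff / (1 + (n : ℚ) * Format.Binary32.unitRoundoff)
        * ∑ i ∈ range (n + 1), |(a i).toRat * (b i).toRat| :=
  abs_seqSum_dot_sub_le_langeRump (by decide) Format.E4M3_mul_E4M3_exact_in_Binary32 a b n hr
    (Binary32_langeRump_restriction hn)

/-- `E2M1 × E2M1 → bfloat16`, recursive, EVERY `n`: factor `((1+2u)ⁿ - 1)/((1+2u)ⁿ + 1) < 1`.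
[cite: LangeRump2018, Thm 10] -/
theorem E2M1_dot_BFloat16_allN (a b : ℕ → MiniFloat Format.E2M1) (n : ℕ)
    (hr : InRange Format.BFloat16 (fun i => (a i).toRat * (b i).toRat) n) :
    |(seqSum Format.BFloat16 (fun i => (a i).toRat * (b i).toRat) n).toRat
        - ∑ i ∈ range (n + 1), (a i).toRat * (b i).toRat|
      ≤ langeRumpAllN Format.BFloat16 n * ∑ i ∈ range (n + 1), |(a i).toRat * (b i).toRat| :=
  abs_seqSum_dot_sub_le_allN (by decide) Format.E2M1_mul_E2M1_exact_in_BFloat16 a b n hr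

/-! ### Range from the data (appended): no per-node hypothesis -/

/-- LANGE–RUMP, ANY ORDER, DATA-ONLY HYPOTHESES: leaves values of `α` (`emaxCode ≥ 2`),
`(1 + (n-1)·u/(1+u))·Σ|xᵢ| ≤ maxRat` (every node then stays in range, `AccumulateRange.lean`) and
`n - 1 ≤ ½u⁻¹` ⟹ `|ŝ - s| ≤ (n-1)u/(1+(n-1)u)·Σ|xᵢ|`. [cite: BoldoEtAl2023, Thm 4.5] -/
theorem abs_eval_sub_exact_le_langeRump_of_absSum_le (hα : 2 ≤ α.emaxCode)
    (t : Literature.ComputerArithmetic.JeannerodRump2018.SumTree)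
    (hleaves : ∀ x ∈ t.leaves, ∃ y : MiniFloat α, y.toRat = x)
    (hsum : (1 + ((t.leaves.length : ℚ) - 1) * (α.unitRoundoff / (1 + α.unitRoundoff)))
      * Literature.ComputerArithmetic.JeannerodRump2018.SumTree.absSum t ≤ α.maxRat)
    (hk : 2 * ((t.leaves.length : ℚ) - 1) * α.unitRoundoff ≤ 1) :
    |Literature.ComputerArithmetic.JeannerodRump2018.SumTree.eval (flα α) t
        - Literature.ComputerArithmetic.JeannerodRump2018.SumTree.exact t|
      ≤ ((t.leaves.length : ℚ) - 1) * α.unitRoundoff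
        / (1 + ((t.leaves.length : ℚ) - 1) * α.unitRoundoff)
        * Literature.ComputerArithmetic.JeannerodRump2018.SumTree.absSum t :=
  abs_eval_sub_exact_le_langeRump hα t (treeInRange_of_absSum_le hα t hleaves hsum) hk

/-- HEIGHT BOUND, DATA-ONLY HYPOTHESES: leaves values of `α`, the same range inequality and
`(h+1)²u ≤ 1` ⟹ `|ŝ - s| ≤ h·u·Σ|xᵢ|`. [cite: BoldoEtAl2023, Thm 4.4] -/
theorem abs_eval_sub_exact_le_height_of_absSum_le (hα : 2 ≤ α.emaxCode)
    (t : Literature.ComputerArithmetic.JeannerodRump2018.SumTree)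
    (hleaves : ∀ x ∈ t.leaves, ∃ y : MiniFloat α, y.toRat = x)
    (hsum : (1 + ((t.leaves.length : ℚ) - 1) * (α.unitRoundoff / (1 + α.unitRoundoff)))
      * Literature.ComputerArithmetic.JeannerodRump2018.SumTree.absSum t ≤ α.maxRat)
    (hh : ((treeHeight t : ℚ) + 1) ^ 2 * α.unitRoundoff ≤ 1) :
    |Literature.ComputerArithmetic.JeannerodRump2018.SumTree.eval (flα α) t
        - Literature.ComputerArithmetic.JeannerodRump2018.SumTree.exact t|
      ≤ (treeHeight t : ℚ) * α.unitRoundoff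
        * Literature.ComputerArithmetic.JeannerodRump2018.SumTree.absSum t :=
  abs_eval_sub_exact_le_height_langeRump hα t (treeInRange_of_absSum_le hα t hleaves hsum) hh

end MiniFloat

end Literature.ComputerArithmetic.FloatingPoint
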